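import Literature.Geometry.Symplectic.SymplecticHomologicalOrientation
import Literature.Geometry.Symplectic.SymplecticWedgeSquare
import Literature.Geometry.Symplectic.SymplecticArea
import Literature.Geometry.Symplectic.ComplexStructureOrientation
import Literature.Geometry.Symplectic.AlmostComplexStructure
import Literature.NumberTheory.Transcendental.DeRhamTheoremMultiplicative
import HarnessLib

/-!
# The orientation induced by an almost complex structure on a `4`-manifold, homologically:
# "`J` is compatible with the orientation" as de Rham positivity of `J`-positive volume forms

Topic `Literature/Geometry/Symplectic`.  McDuff–Salamon, *Introduction to Symplectic Topology*
(3rd ed. 2017): Rem. 4.1.10 ("Let `M` be a closed oriented smooth `4`-manifold, let `J` be an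
almost complex structure on `M` … `c² = 2χ + 3σ`" — `J` inducing the orientation), Rem. 4.1.12
("`J` is compatible with the orientation"), Ex. 4.1.11 (ii)–(iii) (almost complex structures
"induce the same orientation of `M`" / "induce opposite orientations of `M`"); §4.1: "Every almost
complex manifold is oriented"; Def. 4.1.4 / §2.1 Cor. 2.1.4: `ω ∧ ω` is a volume form.  An almost
complex structure `J` orients each tangent space by its `J`-adapted frames `(v, Jv, w, Jw)` (the
tree's `ComplexStructure.orientation`, `ComplexStructureOrientation.lean`: any two adapted frames
differ by a matrix commuting with `J`, of positive determinant).  This file names that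
orientation on the HOMOLOGICAL side of the tree — on `μ : HomologicalOrientation ℤ N 4` — in the
generator-free way of `SymplecticHomologicalOrientation.lean` (see there for why the tree's bridge
from smooth to homological orientations, `homologicalOrientationOfSmooth`, cannot be used: its
reference generator is a `Classical.choice`, so nothing orientation-odd about it is decidable):

* `AlmostComplexStructure.IsPositiveTopForm J v` — the top-degree form `v` is **`J`-positive**:
  `v_x(b) > 0` on every `J_x`-adapted basis `b = (b₀, J b₀, b₂, J b₂)` of every tangent space;
  it suffices to check one adapted frame at each point (`isPositiveTopForm_of_forall_exists`),
  such forms vanish nowhere and form a convex cone;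
* `HomologicalOrientation.IsComplexOrientationOf μ J` — **`μ` is the orientation induced by `J`**
  ("`J` is compatible with `μ`"): some `J`-positive smooth (closed) top form `v` has positive total
  volume on `[N]_μ`, `0 < ⟨[v], [N]_μ ⊗ 1⟩` (the tree's `periodFunctional v … μ.fundamentalClass`:
  de Rham's integration isomorphism and the Kronecker pairing, i.e. `∫_{(N, μ)} v > 0`).

PROVED (closed connected `N`; 0 named facts):

* **independence of `v`** (`IsPositiveTopForm.periodFunctional_fundamentalClass_pos`): if one
  `J`-positive closed smooth top form has positive volume on `[N]_μ` then all have — the segment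
  `(1 - t) v₀ + t v₁` consists of `J`-positive, hence nowhere-vanishing, closed top forms, whose
  volumes `⟨[v_t], [N]_μ ⊗ 1⟩ ≠ 0` (the tree's
  `kroneckerPairing_integrationDeRham_fundamentalClass_ne_zero`) depend affinely on `t`, so do not
  change sign; hence `μ` and `-μ` are not both induced by `J` (`IsComplexOrientationOf.not_neg`),
  the induced orientation is unique (`IsComplexOrientationOf.unique`), and given any `J`-positive
  closed smooth top form exactly one of `μ`, `-μ` is induced by `J` (`isComplexOrientationOf_or_neg`);
* **the orientation of `ω ∧ ω` is the orientation of `J`** for `J` compatible with a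
  smooth `2`-form `s` (`J.IsCompatibleWith s`: `s(v, Jv) > 0`, `s(J·, J·) = s`), `s ∧ s` is
  `J`-positive — on an adapted frame `(s ∧ s)(e, Je, f, Jf) = 2 (g(e,e) g(f,f) - g(e,f)² - g(Je,f)²) > 0`
  for the metric `g = s(·, J·)`, the Cauchy–Schwarz inequality of the hermitian metric `g + i s`
  (`wedge_self_apply_pos_of_compatible`, `isPositiveTopForm_wedge_self_of_isCompatibleWith`);
  consequently, for closed `s`, **`μ.IsSymplecticOrientationOf s ↔ μ.IsComplexOrientationOf J`**
  (`isSymplecticOrientationOf_iff_isComplexOrientationOf`; `⟨[s] ⌣ [s], [N]_μ⟩ = ⟨[s ∧ s], [N]_μ⟩`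
  by the multiplicativity of de Rham's isomorphism, `integrationDeRhamIsoFamily_isMultiplicative`),
  and an almost complex structure compatible with some smooth nondegenerate `2`-form (closed or
  not) induces exactly one homological orientation of a closed connected `4`-manifold
  (`exists_isComplexOrientationOf_of_isCompatibleWith`, `existsUnique_…`).

What is NOT here: that EVERY almost complex structure on a closed `4`-manifold induces an
orientation homologically (`∃ μ, μ.IsComplexOrientationOf J` for arbitrary `J`) — it needs a
`J`-positive smooth volume form, i.e. a smooth `J`-compatible metric / `2`-form (partition of
unity), which the tree does not yet construct; the statements of Rem. 4.1.10 / 4.1.12 for such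
`J` quantify over `μ` with `μ.IsComplexOrientationOf J`, non-vacuously whenever `J` is compatible
with a smooth nondegenerate `2`-form (in particular for every symplectic `(N, s)` and
`s`-compatible `J`, McDuff–Salamon Prop. 4.1.1 (i)).

## References

* D. McDuff, D. Salamon, *Introduction to Symplectic Topology*, 3rd ed., OUP (2017), §4.1
  (before Prop. 4.1.1), Rem. 4.1.10, Ex. 4.1.11 (ii)–(iii), Rem. 4.1.12; §2.1 Cor. 2.1.4.
  [McDuffSalamon2017]
* R. E. Gompf, A. I. Stipsicz, *4-Manifolds and Kirby Calculus*, GSM 20 (1999), §1.4 (almost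
  complex structures and the orientation, Thm. 1.4.13 ff.). [GompfStipsiczGSM1999]
* G. E. Bredon, *Topology and Geometry* (1993), Thm. V.9.5 (de Rham). [Bredon1993]
-/

noncomputable section

open scoped Manifold ContDiff Topology
open Set Function Module
open Literature.Geometry.Kaehler (MForm IsSmoothForm IsClosedForm closedSmoothForms deRhamCohomology
  mextDeriv)
open Literature.AlgebraicTopology.SingularHomology Literature.NumberTheory.Transcendental
open Literature.Geometry.Manifold

namespace Literature.Geometry.Symplectic

/-! ### Linear algebra: `a ∧ a > 0` on `J`-complex frames for `J` compatible with `a` -/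

section Algebra

variable {V : Type*} [NormedAddCommGroup V] [NormedSpace ℝ V]

/-- Additivity of a `2`-form in the first slot. [folklore] -/
private theorem twoForm_add_left (a : V [⋀^Fin 2]→L[ℝ] ℝ) (x y z : V) :
    a ![x + y, z] = a ![x, z] + a ![y, z] :=
  a.vecCons_add _ _ _

/-- Homogeneity of a `2`-form in the first slot. [folklore] -/
private theorem twoForm_smul_left (a : V [⋀^Fin 2]→L[ℝ] ℝ) (c : ℝ) (x z : V) :
    a ![c • x, z] = c * a ![x, z] := by
  rw [a.vecCons_smul, smul_eq_mul]

/-- Additivity of a `2`-form in the second slot. [folklore] -/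
private theorem twoForm_add_right (a : V [⋀^Fin 2]→L[ℝ] ℝ) (x y z : V) :
    a ![x, y + z] = a ![x, y] + a ![x, z] := by
  rw [alt_two_swap_args a (y + z) x, twoForm_add_left, alt_two_swap_args a x y,
    alt_two_swap_args a x z]
  ring

/-- Homogeneity of a `2`-form in the second slot. [folklore] -/
private theorem twoForm_smul_right (a : V [⋀^Fin 2]→L[ℝ] ℝ) (c : ℝ) (x z : V) :
    a ![x, c • z] = c * a ![x, z] := by
  rw [alt_two_swap_args a (c • z) x, twoForm_smul_left, alt_two_swap_args a z x]
  ring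

/-- A `2`-form is odd in the first slot. [folklore] -/
private theorem twoForm_neg_left (a : V [⋀^Fin 2]→L[ℝ] ℝ) (x z : V) : a ![-x, z] = -a ![x, z] := by
  rw [← neg_one_smul ℝ x, twoForm_smul_left]
  ring

/-- A `2`-form is odd in the second slot. [folklore] -/
private theorem twoForm_neg_right (a : V [⋀^Fin 2]→L[ℝ] ℝ) (x z : V) : a ![x, -z] = -a ![x, z] := by
  rw [← neg_one_smul ℝ z, twoForm_smul_right]
  ring

/-- Subtraction in the first slot. [folklore] -/
private theorem twoForm_sub_left (a : V [⋀^Fin 2]→L[ℝ] ℝ) (x y z : V) :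
    a ![x - y, z] = a ![x, z] - a ![y, z] := by
  rw [sub_eq_add_neg, twoForm_add_left, twoForm_neg_left, sub_eq_add_neg]

/-- Subtraction in the second slot. [folklore] -/
private theorem twoForm_sub_right (a : V [⋀^Fin 2]→L[ℝ] ℝ) (x y z : V) :
    a ![x, y - z] = a ![x, y] - a ![x, z] := by
  rw [sub_eq_add_neg, twoForm_add_right, twoForm_neg_right, sub_eq_add_neg]

/-- A `2`-form vanishes on a repeated vector. [folklore] -/
private theorem twoForm_self (a : V [⋀^Fin 2]→L[ℝ] ℝ) (x : V) : a ![x, x] = 0 := by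
  have h := alt_two_swap_args a x x
  linarith

/-- **`(a ∧ a)(e, Je, f, Jf) > 0` on every `J`-complex frame, for a complex structure `J`
compatible with the `2`-form `a`** (`a(v, Jv) > 0` for `v ≠ 0`, `a(J·, J·) = a`).  With the metric
`g(v, w) = a(v, Jw)` (symmetric, positive definite, `J`-invariant; McDuff–Salamon 2017, (4.1.3)),
`(a ∧ a)(e, Je, f, Jf) = 2 (g(e, e) g(f, f) - g(e, f)² - g(Je, f)²)`, and
`g(e, e) · (g(e, e) g(f, f) - g(e, f)² - g(Je, f)²) = g(u, u) > 0` for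
`u = g(e, e) f - g(e, f) e - g(Je, f) Je ≠ 0` — the Cauchy–Schwarz inequality for the hermitian
metric `g + i a`, strict because `f ∉ span{e, Je}`.  At one point this says that the volume form
`ω ∧ ω` of a nondegenerate `ω` (McDuff–Salamon 2017, Cor. 2.1.4) is positive on the frames orienting
a compatible `J` (§4.1, (4.1.3): `g_J = ω(·, J·)` is a metric). [cite: McDuffSalamon2017, §4.1 (4.1.3) and Cor. 2.1.4] -/
theorem wedge_self_apply_pos_of_compatible (a : V [⋀^Fin 2]→L[ℝ] ℝ) (J : V →L[ℝ] V)
    (hJ : ∀ v, J (J v) = -v) (hpos : ∀ v, v ≠ 0 → 0 < a ![v, J v])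
    (hinv : ∀ v w, a ![J v, J w] = a ![v, w]) {e f : V}
    (hli : LinearIndependent ℝ ![e, J e, f, J f]) :
    0 < a.wedge a ![e, J e, f, J f] := by
  -- the metric `g(v, w) = a(v, Jw)` is symmetric
  have hsymm : ∀ v w, a ![v, J w] = a ![w, J v] := fun v w ↦ by
    have h1 := hinv v (J w)
    rw [hJ, twoForm_neg_right] at h1
    rw [← h1, alt_two_swap_args a w (J v), neg_neg]
  have he : e ≠ 0 := by simpa using hli.ne_zero 0
  have hp : 0 < a ![e, J e] := hpos e he
  -- the values of `a` on pairs from the frame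
  have v1 : a ![f, J e] = a ![e, J f] := hsymm f e
  have v2 : a ![f, e] = -a ![e, f] := alt_two_swap_args a e f
  have v3 : a ![e, e] = 0 := twoForm_self a e
  have v4 : a ![J e, J f] = a ![e, f] := hinv e f
  have v5 : a ![J e, J e] = 0 := twoForm_self a (J e)
  have v6 : a ![J e, e] = -a ![e, J e] := alt_two_swap_args a e (J e)
  have v7 : a ![J e, f] = -a ![e, J f] := by
    have h1 := hinv e (-(J f))
    rw [map_neg, hJ, neg_neg, twoForm_neg_right] at h1
    exact h1
  -- the vector `u = p f - r e - m Je`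
  set p := a ![e, J e] with hp_def
  set q := a ![f, J f] with hq_def
  set r := a ![e, J f] with hr_def
  set m := a ![e, f] with hm_def
  set u := p • f - r • e - m • J e with hu_def
  have hu : u ≠ 0 := by
    intro h0
    have hrel : ∑ i, (![-r, -m, p, 0] : Fin 4 → ℝ) i • (![e, J e, f, J f] : Fin 4 → V) i = 0 := by
      rw [Fin.sum_univ_four]
      change (-r) • e + (-m) • J e + p • f + (0 : ℝ) • J f = 0
      rw [← h0, hu_def]
      module
    have h2 := Fintype.linearIndependent_iff.1 hli ![-r, -m, p, 0] hrel 2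
    change p = 0 at h2
    exact hp.ne' h2
  have hJu : J u = p • J f - r • J e + m • e := by
    simp only [hu_def, map_sub, map_smul, hJ, smul_neg, sub_neg_eq_add]
  have hexp : a ![u, J u] = p * (p * q - r * r - m * m) := by
    rw [hJu, hu_def]
    simp only [twoForm_sub_left, twoForm_add_right, twoForm_sub_right, twoForm_smul_left,
      twoForm_smul_right, v1, v2, v3, v4, v5, v6, ← hp_def, ← hq_def, ← hr_def]
    ring
  have key : 0 < p * (p * q - r * r - m * m) := hexp ▸ hpos u hu
  have key' : 0 < p * q - r * r - m * m := by
    by_contra hle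
    push Not at hle
    have := mul_nonpos_iff.2 (Or.inl ⟨hp.le, hle⟩)
    linarith
  rw [wedge_self_apply_two_two]
  change 0 < 2 * (a ![e, J e] * a ![f, J f] - a ![e, f] * a ![J e, J f] + a ![e, J f] * a ![J e, f])
  rw [v4, v7, ← hp_def, ← hq_def, ← hr_def, ← hm_def]
  nlinarith [key']

end Algebra

/-! ### `J`-positive top forms on an almost complex `4`-manifold -/

namespace AlmostComplexStructure

section General

variable {E : Type*} [NormedAddCommGroup E] [NormedSpace ℝ E] {H : Type*} [TopologicalSpace H]
  {I : ModelWithCorners ℝ E H} {M : Type*} [TopologicalSpace M] [ChartedSpace H M]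
  [IsManifold I 1 M] {n : WithTop ℕ∞}

/-- **The complex structure `J_x` of the tangent space at `x`** (`J_x² = -1`), as a
`ComplexStructure` (`ComplexStructureOrientation.lean`). [cite: McDuffSalamon2017, §4.1] -/
def complexStructureAt (J : AlmostComplexStructure I n M) (x : M) : ComplexStructure (TangentSpace I x) :=
  ⟨(J x : TangentSpace I x →L[ℝ] TangentSpace I x), J.map_map x⟩

/-- `J_x` as a linear map is `J x`. [folklore] -/
@[simp] theorem complexStructureAt_J_apply (J : AlmostComplexStructure I n M) (x : M)
    (v : TangentSpace I x) : (J.complexStructureAt x).J v = J x v :=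
  rfl

end General

section Four

variable {N : Type} [TopologicalSpace N] [ChartedSpace (EuclideanSpace ℝ (Fin 4)) N]
  [IsManifold (𝓡 4) ∞ N] {n : WithTop ℕ∞}

omit [IsManifold (𝓡 4) ∞ N] in
/-- The tangent spaces of a `4`-manifold are `4`-dimensional. [folklore] -/
theorem finrank_tangentSpace_four (x : N) : finrank ℝ (TangentSpace (𝓡 4) x) = 4 :=
  finrank_euclideanSpace_fin

/-- **A `J`-positive top form** on an almost complex `4`-manifold `(N, J)`: a `4`-form `v` with
`v_x(b₀, J b₀, b₂, J b₂) > 0` for every `J_x`-adapted basis `b` of every tangent space — a volume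
form of the orientation induced by `J` (McDuff–Salamon 2017, §4.1: for `J` compatible with `ω`,
`ω ∧ ω` is one, `isPositiveTopForm_wedge_self_of_isCompatibleWith`; "Every almost complex manifold
is oriented"; Rem. 4.1.12: "`J` is compatible with the orientation").
[cite: McDuffSalamon2017, §4.1 and Rem. 4.1.12] -/
def IsPositiveTopForm (J : AlmostComplexStructure (𝓡 4) n N) (v : MForm (𝓡 4) N ℝ 4) : Prop :=
  ∀ (x : N) (b : Basis (Fin 4) ℝ (TangentSpace (𝓡 4) x)),
    ComplexStructure.IsAdaptedBasis (J.complexStructureAt x).J b → 0 < v x b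

variable {J : AlmostComplexStructure (𝓡 4) n N} {v v₀ v₁ : MForm (𝓡 4) N ℝ 4}

/-- Unfolding `IsPositiveTopForm`. [folklore] -/
theorem isPositiveTopForm_iff :
    J.IsPositiveTopForm v ↔ ∀ (x : N) (b : Basis (Fin 4) ℝ (TangentSpace (𝓡 4) x)),
      ComplexStructure.IsAdaptedBasis (J.complexStructureAt x).J b → 0 < v x b :=
  Iff.rfl

/-- An adapted basis, as a frame, is `(b₀, J b₀, b₂, J b₂)`. [folklore] -/
theorem coe_eq_of_isAdaptedBasis {x : N} {b : Basis (Fin 4) ℝ (TangentSpace (𝓡 4) x)}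
    (hb : ComplexStructure.IsAdaptedBasis (J.complexStructureAt x).J b) :
    (⇑b : Fin 4 → TangentSpace (𝓡 4) x) = ![b 0, J x (b 0), b 2, J x (b 2)] := by
  funext i
  fin_cases i
  · rfl
  · exact hb.1
  · rfl
  · exact hb.2

/-- **A `J`-positive form is positive on every `J`-complex frame** `(e, Je, f, Jf)` that is
linearly independent. [cite: McDuffSalamon2017, §4.1] -/
theorem IsPositiveTopForm.pos_of_linearIndependent (h : J.IsPositiveTopForm v) (x : N)
    {e f : TangentSpace (𝓡 4) x} (hli : LinearIndependent ℝ ![e, J x e, f, J x f]) :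
    0 < v x ![e, J x e, f, J x f] := by
  have hcard : Fintype.card (Fin 4) = finrank ℝ (TangentSpace (𝓡 4) x) := by
    rw [finrank_tangentSpace_four]; simp
  set b := basisOfLinearIndependentOfCardEqFinrank hli hcard with hb
  have hcoe : (⇑b : Fin 4 → TangentSpace (𝓡 4) x) = ![e, J x e, f, J x f] :=
    coe_basisOfLinearIndependentOfCardEqFinrank hli hcard
  have hab : ComplexStructure.IsAdaptedBasis (J.complexStructureAt x).J b := by
    constructor
    · change b 1 = J x (b 0)
      rw [hcoe]; rfl
    · change b 3 = J x (b 2)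
      rw [hcoe]; rfl
  have := h x b hab
  rwa [hcoe] at this

/-- **A `J`-positive form vanishes nowhere** (adapted bases exist, `exists_isAdaptedBasis`).
[cite: McDuffSalamon2017, §4.1] -/
theorem IsPositiveTopForm.apply_ne_zero (h : J.IsPositiveTopForm v) (x : N) : v x ≠ 0 := by
  obtain ⟨b, hb⟩ := (J.complexStructureAt x).exists_isAdaptedBasis (finrank_tangentSpace_four x)
  intro h0
  have := h x b hb
  rw [h0, ContinuousAlternatingMap.coe_zero, Pi.zero_apply] at this
  exact lt_irrefl 0 this

/-- The sum of `J`-positive forms is `J`-positive. [folklore] -/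
theorem IsPositiveTopForm.add (h₀ : J.IsPositiveTopForm v₀) (h₁ : J.IsPositiveTopForm v₁) :
    J.IsPositiveTopForm (v₀ + v₁) := fun x b hb ↦ by
  rw [Pi.add_apply, ContinuousAlternatingMap.add_apply]
  exact add_pos (h₀ x b hb) (h₁ x b hb)

/-- A positive multiple of a `J`-positive form is `J`-positive. [folklore] -/
theorem IsPositiveTopForm.smul (h : J.IsPositiveTopForm v) {c : ℝ} (hc : 0 < c) :
    J.IsPositiveTopForm (c • v) := fun x b hb ↦ by
  rw [Pi.smul_apply, ContinuousAlternatingMap.smul_apply, smul_eq_mul]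
  exact mul_pos hc (h x b hb)

/-- **`J`-positive forms form a convex set**: `(1 - t) v₀ + t v₁` is `J`-positive for
`t ∈ [0, 1]`. [folklore] -/
theorem IsPositiveTopForm.convex (h₀ : J.IsPositiveTopForm v₀) (h₁ : J.IsPositiveTopForm v₁) {t : ℝ}
    (ht0 : 0 ≤ t) (ht1 : t ≤ 1) : J.IsPositiveTopForm ((1 - t) • v₀ + t • v₁) := fun x b hb ↦ by
  rw [Pi.add_apply, Pi.smul_apply, Pi.smul_apply, ContinuousAlternatingMap.add_apply,
    ContinuousAlternatingMap.smul_apply, ContinuousAlternatingMap.smul_apply, smul_eq_mul, smul_eq_mul]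
  have a0 := h₀ x b hb
  have a1 := h₁ x b hb
  rcases eq_or_lt_of_le ht1 with rfl | ht1'
  · simpa using a1
  · have := mul_pos (sub_pos.2 ht1') a0
    have := mul_nonneg ht0 a1.le
    linarith

/-- **Frame criterion**: a top form positive on ONE `J`-adapted basis at each point is
`J`-positive — any two adapted bases of `J_x` define the same orientation
(`ComplexStructure.orientation_eq_of_isAdaptedBasis`), so the values of a top form on them have
the same sign (`v_x(b') = det_b(b') · v_x(b)`). [cite: McDuffSalamon2017, §4.1] -/
theorem isPositiveTopForm_of_forall_exists
    (h : ∀ x, ∃ b : Basis (Fin 4) ℝ (TangentSpace (𝓡 4) x),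
      ComplexStructure.IsAdaptedBasis (J.complexStructureAt x).J b ∧ 0 < v x b) :
    J.IsPositiveTopForm v := by
  intro x b' hb'
  obtain ⟨b, hb, hpos⟩ := h x
  have hdet : 0 < b.det b' :=
    (Basis.orientation_eq_iff_det_pos _ _).1
      ((J.complexStructureAt x).orientation_eq_of_isAdaptedBasis hb hb')
  have hval : v x b' = v x b * b.det b' := by
    have h1 := (v x).toAlternatingMap.eq_smul_basis_det b
    have h2 := congrArg (fun f : TangentSpace (𝓡 4) x [⋀^Fin 4]→ₗ[ℝ] ℝ ↦ f b') h1
    simp only [AlternatingMap.smul_apply, smul_eq_mul,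
      ContinuousAlternatingMap.coe_toAlternatingMap] at h2
    exact h2
  rw [hval]
  exact mul_pos hpos hdet

/-! ### The orientation induced by `J`, homologically -/

variable [T2Space N]

/-- **`μ` is the orientation induced by `J`** ("`J` is compatible with the orientation `μ`",
McDuff–Salamon 2017, Rem. 4.1.12; Rem. 4.1.10; Ex. 4.1.11 (ii)–(iii)): some `J`-positive smooth
closed top form `v` has positive total volume on the fundamental class of `μ`,
`0 < ⟨[v], [N]_μ ⊗ 1⟩` (`periodFunctional`: de Rham's integration isomorphism and the Kronecker
pairing — `∫_{(N, μ)} v > 0`).  On a closed connected `N` this does not depend on `v`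
(`IsPositiveTopForm.periodFunctional_fundamentalClass_pos`).  A predicate on homological
orientations, insensitive to any choice of generator of local homology.
[cite: McDuffSalamon2017, Rem. 4.1.12 and Rem. 4.1.10] -/
def _root_.Literature.AlgebraicTopology.SingularHomology.HomologicalOrientation.IsComplexOrientationOf
    [SigmaCompactSpace N] (μ : HomologicalOrientation ℤ N 4) (J : AlmostComplexStructure (𝓡 4) n N) :
    Prop :=
  ∃ (v : MForm (𝓡 4) N ℝ 4) (hv : IsSmoothForm v) (hcl : IsClosedForm v),
    J.IsPositiveTopForm v ∧ 0 < periodFunctional v hv hcl μ.fundamentalClass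

/-- Unfolding `IsComplexOrientationOf`. [folklore] -/
theorem isComplexOrientationOf_iff [SigmaCompactSpace N] (μ : HomologicalOrientation ℤ N 4)
    (J : AlmostComplexStructure (𝓡 4) n N) :
    μ.IsComplexOrientationOf J ↔ ∃ (v : MForm (𝓡 4) N ℝ 4) (hv : IsSmoothForm v) (hcl : IsClosedForm v),
      J.IsPositiveTopForm v ∧ 0 < periodFunctional v hv hcl μ.fundamentalClass :=
  Iff.rfl

variable [CompactSpace N]

/-- **Reversing the orientation reverses the total volume**: `⟨[v], [N]_{-μ} ⊗ 1⟩ = -⟨[v], [N]_μ ⊗ 1⟩`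
(Hatcher 2002, §3.3 p. 236; the tree's `fundamentalClass_neg_holds`). [cite: HatcherAT2002, §3.3 p. 236] -/
theorem periodFunctional_fundamentalClass_neg (μ : HomologicalOrientation ℤ N 4) (v : MForm (𝓡 4) N ℝ 4)
    (hv : IsSmoothForm v) (hcl : IsClosedForm v) :
    periodFunctional v hv hcl (-μ).fundamentalClass = -periodFunctional v hv hcl μ.fundamentalClass := by
  rw [HomologicalOrientation.fundamentalClass_neg_holds (R := ℤ) (X := N) 4 μ, map_neg]

variable [ConnectedSpace N]

/-- **A nowhere-vanishing closed top form has non-zero total volume** on a closed connected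
oriented `4`-manifold: `⟨[v], [N]_μ ⊗ 1⟩ ≠ 0` (the tree's
`kroneckerPairing_integrationDeRham_fundamentalClass_ne_zero`: `v` is not exact).
[cite: Bredon1993, Thm. V.9.5] -/
theorem periodFunctional_fundamentalClass_ne_zero (μ : HomologicalOrientation ℤ N 4)
    {v : MForm (𝓡 4) N ℝ 4} (hv : IsSmoothForm v) (hcl : IsClosedForm v) (hne : ∀ x, v x ≠ 0) :
    periodFunctional v hv hcl μ.fundamentalClass ≠ 0 := by
  rw [periodFunctional_apply, intCastAddHom_real_eq_algebraMap]
  exact kroneckerPairing_integrationDeRham_fundamentalClass_ne_zero μ ⟨hv, hcl⟩ hne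

omit [ConnectedSpace N] in
/-- The total volume of a convex combination of closed smooth top forms. [folklore] -/
theorem periodFunctional_convex_fundamentalClass (μ : HomologicalOrientation ℤ N 4)
    (hv₀ : IsSmoothForm v₀) (hcl₀ : IsClosedForm v₀) (hv₁ : IsSmoothForm v₁) (hcl₁ : IsClosedForm v₁)
    (t : ℝ) (hv : IsSmoothForm ((1 - t) • v₀ + t • v₁)) (hcl : IsClosedForm ((1 - t) • v₀ + t • v₁)) :
    periodFunctional ((1 - t) • v₀ + t • v₁) hv hcl μ.fundamentalClass =
      (1 - t) * periodFunctional v₀ hv₀ hcl₀ μ.fundamentalClass +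
        t * periodFunctional v₁ hv₁ hcl₁ μ.fundamentalClass := by
  have hs₀ : (1 - t) • v₀ ∈ closedSmoothForms (𝓡 4) N ℝ 4 :=
    (closedSmoothForms (𝓡 4) N ℝ 4).smul_mem (1 - t) ⟨hv₀, hcl₀⟩
  have hs₁ : t • v₁ ∈ closedSmoothForms (𝓡 4) N ℝ 4 :=
    (closedSmoothForms (𝓡 4) N ℝ 4).smul_mem t ⟨hv₁, hcl₁⟩
  simp only [periodFunctional_apply]
  rw [realClassOfClosedForm_add ((1 - t) • v₀) (t • v₁) hs₀.1 hs₀.2 hs₁.1 hs₁.2,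
    realClassOfClosedForm_smul (1 - t) v₀ hv₀ hcl₀, realClassOfClosedForm_smul t v₁ hv₁ hcl₁,
    map_add, map_smul, map_smul, LinearMap.add_apply, LinearMap.smul_apply, LinearMap.smul_apply,
    smul_eq_mul, smul_eq_mul]

/-- **The sign of the total volume does not depend on the `J`-positive form** (closed connected
`N`): if `⟨[v₀], [N]_μ ⊗ 1⟩ > 0` for one `J`-positive closed smooth top form then
`⟨[v₁], [N]_μ ⊗ 1⟩ > 0` for every other — along the segment `(1 - t) v₀ + t v₁` of `J`-positive,
hence nowhere-vanishing, closed forms the volume is affine in `t` and never zero.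
[cite: McDuffSalamon2017, §4.1 and Ex. 4.1.11 (ii)] -/
theorem IsPositiveTopForm.periodFunctional_fundamentalClass_pos {μ : HomologicalOrientation ℤ N 4}
    {hv₀ : IsSmoothForm v₀} {hcl₀ : IsClosedForm v₀} {hv₁ : IsSmoothForm v₁} {hcl₁ : IsClosedForm v₁}
    (h₀ : J.IsPositiveTopForm v₀) (h₁ : J.IsPositiveTopForm v₁)
    (hpos : 0 < periodFunctional v₀ hv₀ hcl₀ μ.fundamentalClass) :
    0 < periodFunctional v₁ hv₁ hcl₁ μ.fundamentalClass := by
  set A := periodFunctional v₀ hv₀ hcl₀ μ.fundamentalClass with hA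
  set B := periodFunctional v₁ hv₁ hcl₁ μ.fundamentalClass with hB
  by_contra hle
  push Not at hle
  have hBlt : B < 0 :=
    lt_of_le_of_ne hle (periodFunctional_fundamentalClass_ne_zero μ hv₁ hcl₁ h₁.apply_ne_zero)
  have hAB : 0 < A - B := by linarith
  set t := A / (A - B) with ht
  have ht0 : 0 ≤ t := div_nonneg hpos.le hAB.le
  have ht1 : t ≤ 1 := (div_le_one hAB).2 (by linarith)
  have hmem : (1 - t) • v₀ + t • v₁ ∈ closedSmoothForms (𝓡 4) N ℝ 4 :=
    (closedSmoothForms (𝓡 4) N ℝ 4).add_mem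
      ((closedSmoothForms (𝓡 4) N ℝ 4).smul_mem (1 - t) ⟨hv₀, hcl₀⟩)
      ((closedSmoothForms (𝓡 4) N ℝ 4).smul_mem t ⟨hv₁, hcl₁⟩)
  have hne := periodFunctional_fundamentalClass_ne_zero μ hmem.1 hmem.2
    ((h₀.convex h₁ ht0 ht1).apply_ne_zero)
  apply hne
  rw [periodFunctional_convex_fundamentalClass μ hv₀ hcl₀ hv₁ hcl₁ t hmem.1 hmem.2, ← hA, ← hB, ht]
  field_simp
  ring

variable {μ ν : HomologicalOrientation ℤ N 4}

/-- **Every `J`-positive closed smooth top form has positive total volume on the orientation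
induced by `J`.** [cite: McDuffSalamon2017, Rem. 4.1.12] -/
theorem _root_.Literature.AlgebraicTopology.SingularHomology.HomologicalOrientation.IsComplexOrientationOf.periodFunctional_fundamentalClass_pos
    (h : μ.IsComplexOrientationOf J) (hv : IsSmoothForm v) (hcl : IsClosedForm v)
    (hJv : J.IsPositiveTopForm v) : 0 < periodFunctional v hv hcl μ.fundamentalClass := by
  obtain ⟨v₀, hv₀, hcl₀, h₀, hpos⟩ := h
  exact h₀.periodFunctional_fundamentalClass_pos hJv hpos

/-- **`μ` and `-μ` are not both induced by `J`.** [cite: McDuffSalamon2017, Ex. 4.1.11 (ii)-(iii)] -/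
theorem _root_.Literature.AlgebraicTopology.SingularHomology.HomologicalOrientation.IsComplexOrientationOf.not_neg
    (h : μ.IsComplexOrientationOf J) : ¬ (-μ).IsComplexOrientationOf J := by
  rintro ⟨v₁, hv₁, hcl₁, h₁, hpos₁⟩
  rw [periodFunctional_fundamentalClass_neg] at hpos₁
  have := h.periodFunctional_fundamentalClass_pos hv₁ hcl₁ h₁
  linarith

/-- **The orientation induced by `J` is unique** (a connected closed manifold has exactly the two
orientations `ν`, `-ν`: the tree's `eq_or_eq_neg_of_connected_holds`). [cite: HatcherAT2002, §3.3 p. 234] -/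
theorem _root_.Literature.AlgebraicTopology.SingularHomology.HomologicalOrientation.IsComplexOrientationOf.unique
    (hμ : μ.IsComplexOrientationOf J) (hν : ν.IsComplexOrientationOf J) : μ = ν := by
  rcases HomologicalOrientation.eq_or_eq_neg_of_connected_holds N μ ν with h | h
  · exact h
  · subst h
    exact absurd hμ hν.not_neg

/-- **Given a `J`-positive closed smooth top form, exactly one of `μ`, `-μ` is induced by `J`**
(its total volume is non-zero and changes sign with the orientation). [cite: McDuffSalamon2017, Rem. 4.1.12] -/
theorem isComplexOrientationOf_or_neg (μ : HomologicalOrientation ℤ N 4) (hv : IsSmoothForm v)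
    (hcl : IsClosedForm v) (hJv : J.IsPositiveTopForm v) :
    μ.IsComplexOrientationOf J ∨ (-μ).IsComplexOrientationOf J := by
  rcases lt_trichotomy (periodFunctional v hv hcl μ.fundamentalClass) 0 with hlt | heq | hgt
  · refine Or.inr ⟨v, hv, hcl, hJv, ?_⟩
    rw [periodFunctional_fundamentalClass_neg]
    linarith
  · exact absurd heq (periodFunctional_fundamentalClass_ne_zero μ hv hcl hJv.apply_ne_zero)
  · exact Or.inl ⟨v, hv, hcl, hJv, hgt⟩

/-- Given a `J`-positive closed smooth top form, `J` induces some homological orientation (closed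
connected `N`). [cite: McDuffSalamon2017, Rem. 4.1.12] -/
theorem exists_isComplexOrientationOf (μ : HomologicalOrientation ℤ N 4) (hv : IsSmoothForm v)
    (hcl : IsClosedForm v) (hJv : J.IsPositiveTopForm v) :
    ∃ ν : HomologicalOrientation ℤ N 4, ν.IsComplexOrientationOf J := by
  rcases isComplexOrientationOf_or_neg μ hv hcl hJv with h | h
  exacts [⟨μ, h⟩, ⟨-μ, h⟩]

end Four

end AlmostComplexStructure

/-! ### For `J` compatible with `ω`, the orientation of `ω ∧ ω` is the orientation of `J` -/

section Symplectic

open AlmostComplexStructure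

variable {N : Type} [TopologicalSpace N] [ChartedSpace (EuclideanSpace ℝ (Fin 4)) N]
  [IsManifold (𝓡 4) ∞ N] {n : WithTop ℕ∞} {J : AlmostComplexStructure (𝓡 4) n N}
  {s : MForm (𝓡 4) N ℝ 2}

/-- **`s ∧ s` is `J`-positive for `J` compatible with `s`** (the volume form `ω ∧ ω`,
McDuff–Salamon 2017, Cor. 2.1.4 / Def. 4.1.4, is positive on the `J`-adapted frames, §4.1 (4.1.3)):
on an adapted frame `(s ∧ s)(e, Je, f, Jf) > 0` (`wedge_self_apply_pos_of_compatible`).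
[cite: McDuffSalamon2017, §4.1 (4.1.3) and Def. 4.1.4] -/
theorem isPositiveTopForm_wedge_self_of_isCompatibleWith (hJ : J.IsCompatibleWith s) :
    J.IsPositiveTopForm ((s.wedge s).castDeg two_add_two_eq_four) := by
  intro x b hb
  have hcoe := coe_eq_of_isAdaptedBasis hb
  have hli : LinearIndependent ℝ (⇑b) := b.linearIndependent
  rw [hcoe] at hli
  -- the pointwise lemma on the model space `ℝ⁴ = T_x N` (as in `MForm.wedge`)
  have h := wedge_self_apply_pos_of_compatible (V := EuclideanSpace ℝ (Fin 4)) (s x) (J x)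
    (J.map_map x) (fun v hv ↦ hJ.pos x hv) (hJ.map_map x) hli
  rw [MForm.castDeg_apply, MForm.wedge_apply]
  simp only [Fin.cast_eq_self]
  rw [hcoe]
  exact h

/-- A compatible pair makes `s` non-degenerate (`s(v, Jv) > 0`). [cite: McDuffSalamon2017, §4.1] -/
theorem nondegenerate_of_isCompatibleWith (hJ : J.IsCompatibleWith s) (x : N) (v : TangentSpace (𝓡 4) x)
    (hv : v ≠ 0) : ∃ w : TangentSpace (𝓡 4) x, s x ![v, w] ≠ 0 :=
  ⟨J x v, (hJ.pos x hv).ne'⟩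

omit [IsManifold (𝓡 4) ∞ N] in
/-- A `5`-form on a `4`-manifold vanishes. [folklore] -/
theorem mform_five_eq_zero (α : MForm (𝓡 4) N ℝ 5) : α = 0 := by
  funext x
  ext w
  have hdep : ¬ LinearIndependent ℝ w := fun hw ↦ by
    have := hw.fintype_card_le_finrank
    rw [finrank_tangentSpace_four] at this
    simp at this
  rw [Pi.zero_apply, ContinuousAlternatingMap.coe_zero, Pi.zero_apply]
  have h := (α x).toAlternatingMap.map_linearDependent w hdep
  rwa [ContinuousAlternatingMap.coe_toAlternatingMap] at h

omit [IsManifold (𝓡 4) ∞ N] in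
/-- **Top forms on a `4`-manifold are closed** (`dα` is a `5`-form). [folklore] -/
theorem isClosedForm_four (α : MForm (𝓡 4) N ℝ 4) : IsClosedForm α :=
  mform_five_eq_zero _

variable [T2Space N] [CompactSpace N]

/-- **`⟨[s] ⌣ [s], [N]_μ⟩ = ⟨[s ∧ s], [N]_μ ⊗ 1⟩`** for a closed smooth `2`-form on a closed
`4`-manifold: the symplectic pairing is the total volume of `s ∧ s` (de Rham's isomorphism is
multiplicative, `integrationDeRhamIsoFamily_isMultiplicative`, and `[s] ⌣ [s] = [s ∧ s]` in
`H⁴_dR`). [cite: Bredon1993, Thm. V.9.5] [cite: McDuffSalamon2017, §4.4] -/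
theorem symplecticPairing_eq_periodFunctional_wedge_self (μ : HomologicalOrientation ℤ N 4)
    (s : MForm (𝓡 4) N ℝ 2) (hs : IsSmoothForm s) (hcl : IsClosedForm s) :
    symplecticPairing μ s hs hcl =
      periodFunctional ((s.wedge s).castDeg two_add_two_eq_four)
        (wedge_self_castDeg_mem_closedSmoothForms ⟨hs, hcl⟩).1
        (wedge_self_castDeg_mem_closedSmoothForms ⟨hs, hcl⟩).2 μ.fundamentalClass := by
  haveI := wedgeFacts_four (N := N)
  have hm : (integrationDeRhamIsoFamily (EuclideanSpace ℝ (Fin 4))).IsMultiplicative :=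
    integrationDeRhamIsoFamily_isMultiplicative
  have h := hm N 2 2 4 two_add_two_eq_four (deRhamCohomology.mk ⟨s, hs, hcl⟩)
    (deRhamCohomology.mk ⟨s, hs, hcl⟩)
  rw [symplecticPairing_eq, periodFunctional_apply, realFundamentalClass_eq, realClassOfClosedForm_eq,
    realClassOfClosedForm_eq, ← h, cup_self_deRham_eq ⟨hs, hcl⟩]

variable [ConnectedSpace N]

/-- **For `J` compatible with a closed `2`-form `s` on a closed connected `4`-manifold, the
symplectic orientation of `s` is the orientation induced by `J`** (McDuff–Salamon 2017, Def. 4.1.4: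
the symplectic orientation is that of `ω ∧ ω`; §4.1 / Rem. 4.1.12: the orientation with which `J` is
compatible): `μ.IsSymplecticOrientationOf s ↔ μ.IsComplexOrientationOf J`.
[cite: McDuffSalamon2017, Def. 4.1.4, §4.1 and Rem. 4.1.12] -/
theorem isSymplecticOrientationOf_iff_isComplexOrientationOf (hJ : J.IsCompatibleWith s)
    (hs : IsSmoothForm s) (hcl : IsClosedForm s) (μ : HomologicalOrientation ℤ N 4) :
    μ.IsSymplecticOrientationOf s hs hcl ↔ μ.IsComplexOrientationOf J := by
  have hpos := isPositiveTopForm_wedge_self_of_isCompatibleWith hJ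
  rw [isSymplecticOrientationOf_iff, symplecticPairing_eq_periodFunctional_wedge_self]
  exact ⟨fun h ↦ ⟨_, _, _, hpos, h⟩, fun h ↦ h.periodFunctional_fundamentalClass_pos _ _ hpos⟩

/-- **An almost complex structure compatible with a smooth `2`-form induces an orientation,
homologically**, on a closed connected `4`-manifold (`s` need not be closed: `s ∧ s` is a
`J`-positive smooth top form, closed for degree reasons). [cite: McDuffSalamon2017, §4.1 and Rem. 4.1.12] -/
theorem exists_isComplexOrientationOf_of_isCompatibleWith (hJ : J.IsCompatibleWith s)
    (hs : IsSmoothForm s) : ∃ μ : HomologicalOrientation ℤ N 4, μ.IsComplexOrientationOf J := by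
  haveI := wedgeFacts_four (N := N)
  have hsm : IsSmoothForm ((s.wedge s).castDeg two_add_two_eq_four) :=
    isSmoothForm_castDeg two_add_two_eq_four (isSmoothForm_wedge hs hs)
  exact exists_isComplexOrientationOf
    (symplecticOrientation s hs (nondegenerate_of_isCompatibleWith hJ)) hsm (isClosedForm_four _)
    (isPositiveTopForm_wedge_self_of_isCompatibleWith hJ)

/-- **… and exactly one.** [cite: McDuffSalamon2017, §4.1 and Rem. 4.1.12] -/
theorem existsUnique_isComplexOrientationOf_of_isCompatibleWith (hJ : J.IsCompatibleWith s)
    (hs : IsSmoothForm s) : ∃! μ : HomologicalOrientation ℤ N 4, μ.IsComplexOrientationOf J := by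
  obtain ⟨μ, hμ⟩ := exists_isComplexOrientationOf_of_isCompatibleWith hJ hs
  exact ⟨μ, hμ, fun ν hν ↦ hν.unique hμ⟩

/-- **Two almost complex structures compatible with the same closed `2`-form induce the same
orientation** (both induce the symplectic orientation of `s`). [cite: McDuffSalamon2017, §4.1] -/
theorem isComplexOrientationOf_iff_of_isCompatibleWith {n' : WithTop ℕ∞}
    {J' : AlmostComplexStructure (𝓡 4) n' N} (hJ : J.IsCompatibleWith s) (hJ' : J'.IsCompatibleWith s)
    (hs : IsSmoothForm s) (hcl : IsClosedForm s) (μ : HomologicalOrientation ℤ N 4) :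
    μ.IsComplexOrientationOf J ↔ μ.IsComplexOrientationOf J' := by
  rw [← isSymplecticOrientationOf_iff_isComplexOrientationOf hJ hs hcl,
    isSymplecticOrientationOf_iff_isComplexOrientationOf hJ' hs hcl]

end Symplectic

end Literature.Geometry.Symplectic

end
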